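import Mathlib
import Summits.Ventures.PercRepro2.HCov
import Summits.Ventures.PercRepro2.BHKAvoid
import Summits.Ventures.PercRepro2.ISplit
import Summits.Ventures.PercRepro2.FirstOrderTerms
import Summits.Ventures.PercRepro2.FirstOrderSlopeG
import Summits.Ventures.PercRepro2.PendantCovMass

/-!
# The open inequality `D(β, γ) ≥ 0` is exactly the case of a negative `T`-covariance
(blind cell PercRepro2, p5 g23; `proofs/P5-OEDGE.md` §29, `S4-HARDSTEP.md` v97)

With `t = P(T)`, `t_x = P(T, x ∈ C₁)`, `t_bo = P(T, b, o ∈ C₁)`, `D = P(PD)`, `D_o = P(PD, o ∈ U)`,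
`β = P(b ↔ a₁)`:

  `t·Dmix = D·(t·t_bo − t_b·t_o) + (β·t − t_b)·(D_o·t − D·t_o)`   (`t_mul_Dmix_eq`),

i.e. `D(β, γ) = t·[Cov_T(L_b, L_o) + (β − β_T)(γ − γ_T)]` with both shifts theorem-signed
(`T_bL_le_beta_mul`: `t_b ≤ β·t`; `T_xL_mul_R_le` + `PD_oL_le_Do`: `D·t_o ≤ D_o·t`). Hence
**`Dmix_nonneg_of_covT`**: `0 ≤ Dmix` whenever `t_b·t_o ≤ t·t_bo` (`Cov_T(L_b, L_o) ≥ 0`) — the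
open statement of the degree-one-root contraction is the case `Cov_T(L_b, L_o) < 0`, where the
product of the two shifts must pay `|Cov_T|`.
-/

namespace Summit.Ventures.PercRepro2

open UnionCluster

namespace CovForm

namespace FirstOrder

section Main

variable {V : Type*} {E : Type*} [Fintype E] [DecidableEq E] [Fintype V] [DecidableEq V]
  {R : Type*} [Field R] [LinearOrder R] [IsStrictOrderedRing R]

omit [Fintype V] [DecidableEq V] [LinearOrder R] [IsStrictOrderedRing R] in
/-- `t·Dmix = D·(t·t_bo − t_b·t_o) + (β·t − t_b)·(D_o·t − D·t_o)`. -/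
theorem t_mul_Dmix_eq (p : E → R) (ends : E → Sym2 V) (o a₁ a₂ a₃ b : V) :
    prob p (TEvent ends a₁ a₂ a₃) * Dmix p ends o a₁ a₂ a₃ b =
      prob p (PDEvent ends a₁ a₂ a₃) *
          (prob p (TEvent ends a₁ a₂ a₃) *
              prob p (TEvent ends a₁ a₂ a₃ ∩ connEvent ends a₁ b ∩ connEvent ends a₁ o) -
            prob p (TEvent ends a₁ a₂ a₃ ∩ connEvent ends a₁ b) *
              prob p (TEvent ends a₁ a₂ a₃ ∩ connEvent ends a₁ o)) +
        (beta p ends a₁ b * prob p (TEvent ends a₁ a₂ a₃) -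
            prob p (TEvent ends a₁ a₂ a₃ ∩ connEvent ends a₁ b)) *
          (Do p ends o a₁ a₂ a₃ * prob p (TEvent ends a₁ a₂ a₃) -
            prob p (PDEvent ends a₁ a₂ a₃) * prob p (TEvent ends a₁ a₂ a₃ ∩ connEvent ends a₁ o)) := by
  unfold Dmix
  ring

/-- The `o`-shift is theorem-signed: `D·P(T, oL) ≤ D_o·P(T)` (`γ_T ≤ γ`). -/
theorem D_mul_ToL_le_Do_mul_T (p : E → R) (hp : IsProbVec p) (ends : E → Sym2 V)
    (o a₁ a₂ a₃ : V) :
    prob p (PDEvent ends a₁ a₂ a₃) * prob p (TEvent ends a₁ a₂ a₃ ∩ connEvent ends a₁ o) ≤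
      Do p ends o a₁ a₂ a₃ * prob p (TEvent ends a₁ a₂ a₃) := by
  have hR := ISplit.prob_PD_add_T p ends a₁ a₂ a₃ Set.univ
  simp only [Set.inter_univ] at hR
  have hRo := ISplit.prob_PD_add_T p ends a₁ a₂ a₃ (connEvent ends a₁ o)
  have f3 := T_xL_mul_R_le p hp ends a₁ a₂ a₃ o
  rw [← hR, ← hRo] at f3
  have f4 := PD_oL_le_Do p hp ends o a₁ a₂ a₃
  have h0t : 0 ≤ prob p (TEvent ends a₁ a₂ a₃) := prob_nonneg hp _
  nlinarith [f3, mul_le_mul_of_nonneg_left f4 h0t]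

/-- **`D(β, γ) ≥ 0` whenever `Cov_T(L_b, L_o) ≥ 0`** (`t_b·t_o ≤ t·t_bo`): the open statement of
the degree-one-root contraction is the case of a negative `T`-covariance. -/
theorem Dmix_nonneg_of_covT (p : E → R) (hp : IsProbVec p) (ends : E → Sym2 V) (o a₁ a₂ a₃ b : V)
    (hcov : prob p (TEvent ends a₁ a₂ a₃ ∩ connEvent ends a₁ b) *
        prob p (TEvent ends a₁ a₂ a₃ ∩ connEvent ends a₁ o) ≤
      prob p (TEvent ends a₁ a₂ a₃) *
        prob p (TEvent ends a₁ a₂ a₃ ∩ connEvent ends a₁ b ∩ connEvent ends a₁ o)) :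
    0 ≤ Dmix p ends o a₁ a₂ a₃ b := by
  have hid := t_mul_Dmix_eq p ends o a₁ a₂ a₃ b
  have hb := T_bL_le_beta_mul p hp ends a₁ a₂ a₃ b
  have ho := D_mul_ToL_le_Do_mul_T p hp ends o a₁ a₂ a₃
  have h0D : 0 ≤ prob p (PDEvent ends a₁ a₂ a₃) := prob_nonneg hp _
  have h0t : 0 ≤ prob p (TEvent ends a₁ a₂ a₃) := prob_nonneg hp _
  have hprod : 0 ≤ prob p (TEvent ends a₁ a₂ a₃) * Dmix p ends o a₁ a₂ a₃ b := by
    rw [hid]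
    have := mul_nonneg h0D (sub_nonneg.2 hcov)
    have := mul_nonneg (sub_nonneg.2 hb) (sub_nonneg.2 ho)
    linarith
  rcases eq_or_lt_of_le h0t with ht | ht
  · -- `t = 0`: every `T`-mass vanishes and `Dmix = 0`
    have htb : prob p (TEvent ends a₁ a₂ a₃ ∩ connEvent ends a₁ b) = 0 :=
      le_antisymm (ht ▸ prob_inter_le_left hp _ _) (prob_nonneg hp _)
    have hto : prob p (TEvent ends a₁ a₂ a₃ ∩ connEvent ends a₁ o) = 0 :=
      le_antisymm (ht ▸ prob_inter_le_left hp _ _) (prob_nonneg hp _)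
    have htbo : prob p (TEvent ends a₁ a₂ a₃ ∩ connEvent ends a₁ b ∩ connEvent ends a₁ o) = 0 :=
      le_antisymm (htb ▸ prob_inter_le_left hp _ _) (prob_nonneg hp _)
    unfold Dmix
    rw [← ht, htb, hto, htbo]
    ring_nf
    exact le_refl _
  · exact nonneg_of_mul_nonneg_right hprod ht

end Main

end FirstOrder

end CovForm

end Summit.Ventures.PercRepro2
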